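import Literature.NumberTheory.EllipticCurves.HeathBrown1994.CongruentTwoSelmerIskraFamily
import Literature.NumberTheory.EllipticCurves.HeathBrown1994.CongruentTwoSelmerFengXiongFamilies
import Literature.NumberTheory.EllipticCurves.CongruentNumberMonskySelmerRankZero
import Literature.NumberTheory.EllipticCurves.Wiles2000CongruentProofs
import HarnessLib

/-!
# Iskra's and Feng's non-congruent families — `#Sel⁽²⁾(E_n/ℚ) = 4`, rank `0`, `Ш(E_n)[2^∞] = 0` and «`n` is not a congruent
# number» UNCONDITIONALLY, for every number of prime factors

Topic `NumberTheory/EllipticCurves`; namespace `Literature.NumberTheory.EllipticCurves.CongruentNumberMonskySelmer`. A pure proof file.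

The tree PROVES `det M = 1` (Monsky's matrix) UNIFORMLY IN `k` on four families given by graph / symbol conditions
(`HeathBrown1994/CongruentTwoSelmerIskraFamily.lean`, `…OddGraphFamilies.lean`, `…FengXiongFamilies.lean`):
* ISKRA 1996: `n = p₁⋯p_k`, all `pᵢ ≡ 3 (mod 8)`, `(pᵢ/pⱼ) = −1` for `i < j` (`det_monskyMatrixOdd_eq_one_of_iskra`);
* FENG 1996, Thm. 3.1 (I): `n = p₀p₁⋯p_k`, `p₀ ≡ 3 (mod 8)`, `pᵢ ≡ 1 (mod 8)` (`i ≥ 1`), odd graph `G(n)` in kernel form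
  (`ker A = {0, 𝟙}`) (`det_monskyMatrixOdd_eq_one_of_oddGraph`); (II): `n = 2p₀⋯p_k`, `p₀ ≡ 5 (mod 8)`, `pᵢ ≡ 1 (mod 8)`
  (`det_monskyMatrixEven_eq_one_of_oddGraph`);
* FENG–XIONG 2004 Thm. 2.4 (Rhoades 2009 Thm. 2.3): `n = p₀⋯p_k ≡ 3 (mod 8)`, `p₀ ≡ 3 (mod 4)`, `pᵢ ≡ 1 (mod 4)`, `G(n)` odd
  (`det_monskyMatrixOdd_eq_one_of_oddGraph_three_mod_four`); Thm. 2.6: `n = 2p₁⋯p_k`, all `pᵢ ≡ 1 (mod 4)`, `ker(A + D₂) = 0`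
  (`det_monskyMatrixEven_eq_one_of_oddGraph_two`),
and so far derived `BSD(E_n, ℓ)` for them MODULO Monsky's theorem `hM` + the three journal facts. With the upper bound of Monsky's
formula a tree theorem and `det M = 1 ⟹ #Sel₂ = 4` fact-free (`CongruentNumberMonskySelmerRankZero.lean`), THIS FILE records for each
family, UNCONDITIONALLY and uniformly in `k`: `#Sel⁽²⁾(E_n/ℚ) = 4` (`card_selmerGroup_two_of_<family>`), `rk E_n(ℚ) = 0` ∧
`Ш(E_n)[2^∞] = 0` (`rank_zero_sha_two_of_<family>`), and **«`n` is not a congruent number»** (`not_isCongruentNumber_of_<family>`, through the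
tree's dictionary `Wiles2000.mordellWeilRank_ne_zero_iff_isCongruentNumber`) — i.e. ISKRA'S THEOREM and FENG'S / FENG–XIONG'S non-congruence
theorems (in the kernel-form of their graph hypotheses) are now UNCONDITIONAL TREE THEOREMS, together with the vanishing of the `2`-primary
Tate–Shafarevich group on these families; and `BSD(E_n, ℓ)` for every `ℓ` modulo the JOURNAL facts only (`forall_bsdp_of_<family>_descent`).
Nothing about any census class is booked here.

## References

* [Iskra1996] B. Iskra, *Non-congruent numbers with arbitrarily many prime factors congruent to 3 modulo 8*, Proc. Japan Acad. 72 (1996),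
  Theorem (p. 168). [Rhoades2009] R. C. Rhoades, *2-Selmer groups and the Birch–Swinnerton-Dyer conjecture for the congruent number
  curves*, J. Number Theory 129 (2009) = arXiv:0706.4344, §1 and Thms. 2.3–2.4 (= Feng–Xiong 2004 Thms. 2.4, 2.6).
* [Feng1996NonCongruent] K. Feng, Acta Arith. 75 (1996), Thm. 3.1 (I), (II) with Lemma 2.2.
* [HeathBrown1994SelmerCongruentII] Appendix (P. Monsky), typescript p. 39 L10–L33, p. 41 L20–L36. [SilvermanAEC2009] Thm. X.4.2.
* [BurungaleTian2026] Thm. 1.1. [BurungaleFlach2024] Thm. 1.1, Cor. 2. [Miller2011LMS] Def. 1.1.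
-/

noncomputable section

open scoped Classical

open Matrix WeierstrassCurve Literature.NumberTheory.EllipticCurves.HeathBrown1994
  Literature.NumberTheory.EllipticCurves.HeathBrown1994.Families

namespace Literature.NumberTheory.EllipticCurves

namespace CongruentNumberMonskySelmer

/-! ## §1 Iskra's family -/

section Iskra

variable {k : ℕ} (p : Fin k → ℕ)

/-- **`#Sel⁽²⁾(E_n/ℚ) = 4` on Iskra's family** (`n = p₁⋯p_k`, all `pᵢ ≡ 3 (mod 8)`, `(pᵢ/pⱼ) = −1` for `i < j`), unconditionally,
uniformly in `k`. [cite: Iskra1996, Theorem (p. 168)] [cite: HeathBrown1994SelmerCongruentII, Appendix (Monsky), typescript p. 39 L27–L33]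
[cite: SilvermanAEC2009, Thm. X.4.2] -/
theorem card_selmerGroup_two_of_iskra (hp : ∀ i, (p i).Prime) (hinj : Function.Injective p)
    (h3 : ∀ i, p i % 8 = 3) (hT : ∀ i j, i < j → jacobiSym (p i : ℤ) (p j) = -1) :
    Nat.card ((congruentNumberCurve (∏ i, p i)).selmerGroup 2) = 4 :=
  card_selmerGroup_two_eq_four_of_det_odd p hp (fun i => Nat.odd_iff.mpr (by have := h3 i; omega)) hinj
    (det_monskyMatrixOdd_eq_one_of_iskra p hp h3 hT)

/-- **Rank `0` AND `Ш(E_n)[2^∞] = 0` on Iskra's family — UNCONDITIONAL, every `k`.** [cite: Iskra1996, Theorem (p. 168)]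
[cite: SilvermanAEC2009, Thm. X.4.2] -/
theorem rank_zero_sha_two_of_iskra (hp : ∀ i, (p i).Prime) (hinj : Function.Injective p)
    (h3 : ∀ i, p i % 8 = 3) (hT : ∀ i j, i < j → jacobiSym (p i : ℤ) (p j) = -1) :
    haveI := isElliptic_congruentNumberCurve (Squarefree.ne_zero (squarefree_prod_of_injective p hp hinj))
    (congruentNumberCurve (∏ i, p i)).mordellWeilRank = 0 ∧
      AddCommGroup.primaryComponent (congruentNumberCurve (∏ i, p i)).sha 2 = ⊥ :=
  ⟨Smith2016.mordellWeilRank_eq_zero_of_card_selmerGroup_two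
      (Squarefree.ne_zero (squarefree_prod_of_injective p hp hinj)) (card_selmerGroup_two_of_iskra p hp hinj h3 hT),
    Smith2016.primaryComponent_sha_two_eq_bot_of_card_selmerGroup_two
      (Squarefree.ne_zero (squarefree_prod_of_injective p hp hinj)) (card_selmerGroup_two_of_iskra p hp hinj h3 hT)⟩

/-- **ISKRA'S THEOREM, unconditionally**: a product of distinct primes `pᵢ ≡ 3 (mod 8)` with `(pᵢ/pⱼ) = −1` for `i < j` is NOT a
congruent number (any number `k ≥ 1` of factors; `k = 0`, `n = 1`, included). [cite: Iskra1996, Theorem (p. 168)]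
[cite: Rhoades2009, §1 (restatement of Iskra's theorem)] -/
theorem not_isCongruentNumber_of_iskra (hp : ∀ i, (p i).Prime) (hinj : Function.Injective p)
    (h3 : ∀ i, p i % 8 = 3) (hT : ∀ i j, i < j → jacobiSym (p i : ℤ) (p j) = -1) :
    ¬ IsCongruentNumber (∏ i, p i) := fun h =>
  ((Wiles2000.mordellWeilRank_ne_zero_iff_isCongruentNumber
    (Nat.pos_of_ne_zero (Squarefree.ne_zero (squarefree_prod_of_injective p hp hinj)))).mpr h)
    (rank_zero_sha_two_of_iskra p hp hinj h3 hT).1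

/-- **`BSD(E_n, ℓ)` for every prime `ℓ` on Iskra's family**, modulo the journal facts BT26 / Deuring–Hecke / BF24 ONLY (Monsky's
theorem struck). [cite: Iskra1996, Theorem (p. 168)] [cite: BurungaleTian2026, Thm. 1.1 with Cor. 1.4] [cite: BurungaleFlach2024, Cor. 2] -/
theorem forall_bsdp_of_iskra_descent
    (hBT : burungaleTian_analyticRank_eq_zero_of_selmerCorank_eq_zero_of_hasCM)
    (hH : hasEntireLFunction_of_j_mem_maximalCMJInvariants)
    (hBF : bsdTriple_of_hasCM_of_L_one_ne_zero) (hp : ∀ i, (p i).Prime) (hinj : Function.Injective p)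
    (h3 : ∀ i, p i % 8 = 3) (hT : ∀ i j, i < j → jacobiSym (p i : ℤ) (p j) = -1) (ℓ : ℕ) (hℓ : ℓ.Prime) :
    haveI := isElliptic_congruentNumberCurve (Squarefree.ne_zero (squarefree_prod_of_injective p hp hinj))
    haveI := isGloballyMinimal_congruentNumberCurve (squarefree_prod_of_injective p hp hinj)
    BSDp (congruentNumberCurve (∏ i, p i)) ℓ :=
  forall_bsdp_of_BT_BF_odd_descent p hBT hH hBF hp (fun i => Nat.odd_iff.mpr (by have := h3 i; omega)) hinj
    (det_monskyMatrixOdd_eq_one_of_iskra p hp h3 hT) ℓ hℓ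

end Iskra

/-! ## §2 Feng's odd-graph families (I) and (II) -/

section Feng

variable {k : ℕ} (p : Fin (k + 1) → ℕ)

/-- Oddness of the primes of Feng's family (I)/(II) from the residues. [cite: Feng1996NonCongruent, Thm. 3.1 (p. 78)] -/
private theorem odd_of_residues {r : ℕ} (hr : r = 3 ∨ r = 5) (h0 : p 0 % 8 = r) (h1 : ∀ i, i ≠ 0 → p i % 8 = 1) :
    ∀ i, Odd (p i) := by
  intro i
  rcases eq_or_ne i 0 with rfl | hi
  · exact Nat.odd_iff.mpr (by rcases hr with rfl | rfl <;> omega)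
  · have := h1 i hi; exact Nat.odd_iff.mpr (by omega)

/-- **`#Sel⁽²⁾(E_n/ℚ) = 4` on Feng's family (I)** (`n = p₀⋯p_k`, `p₀ ≡ 3 (mod 8)`, `pᵢ ≡ 1 (mod 8)`, odd graph in kernel form),
unconditionally, uniformly in `k`. [cite: Feng1996NonCongruent, Thm. 3.1 (I) (p. 78) with Lemma 2.2 (p. 74)] [cite: SilvermanAEC2009, Thm. X.4.2] -/
theorem card_selmerGroup_two_of_oddGraph_odd (hp : ∀ i, (p i).Prime) (hinj : Function.Injective p)
    (h3 : p 0 % 8 = 3) (h1 : ∀ i, i ≠ 0 → p i % 8 = 1)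
    (hG : ∀ v, legendreMatrix p *ᵥ v = 0 → v = 0 ∨ v = fun _ => 1) :
    Nat.card ((congruentNumberCurve (∏ i, p i)).selmerGroup 2) = 4 :=
  card_selmerGroup_two_eq_four_of_det_odd p hp (odd_of_residues p (Or.inl rfl) h3 h1) hinj
    (det_monskyMatrixOdd_eq_one_of_oddGraph p h3 h1 hG)

/-- **Rank `0` AND `Ш(E_n)[2^∞] = 0` on Feng's family (I) — UNCONDITIONAL, every `k`.** [cite: Feng1996NonCongruent, Thm. 3.1 (I) (p. 78)]
[cite: SilvermanAEC2009, Thm. X.4.2] -/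
theorem rank_zero_sha_two_of_oddGraph_odd (hp : ∀ i, (p i).Prime) (hinj : Function.Injective p)
    (h3 : p 0 % 8 = 3) (h1 : ∀ i, i ≠ 0 → p i % 8 = 1)
    (hG : ∀ v, legendreMatrix p *ᵥ v = 0 → v = 0 ∨ v = fun _ => 1) :
    haveI := isElliptic_congruentNumberCurve (Squarefree.ne_zero (squarefree_prod_of_injective p hp hinj))
    (congruentNumberCurve (∏ i, p i)).mordellWeilRank = 0 ∧
      AddCommGroup.primaryComponent (congruentNumberCurve (∏ i, p i)).sha 2 = ⊥ :=
  ⟨Smith2016.mordellWeilRank_eq_zero_of_card_selmerGroup_two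
      (Squarefree.ne_zero (squarefree_prod_of_injective p hp hinj)) (card_selmerGroup_two_of_oddGraph_odd p hp hinj h3 h1 hG),
    Smith2016.primaryComponent_sha_two_eq_bot_of_card_selmerGroup_two
      (Squarefree.ne_zero (squarefree_prod_of_injective p hp hinj)) (card_selmerGroup_two_of_oddGraph_odd p hp hinj h3 h1 hG)⟩

/-- **FENG'S THEOREM 3.1 (I), unconditionally**: such `n` is NOT a congruent number. [cite: Feng1996NonCongruent, Thm. 3.1 (I) (p. 78)] -/
theorem not_isCongruentNumber_of_oddGraph_odd (hp : ∀ i, (p i).Prime) (hinj : Function.Injective p)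
    (h3 : p 0 % 8 = 3) (h1 : ∀ i, i ≠ 0 → p i % 8 = 1)
    (hG : ∀ v, legendreMatrix p *ᵥ v = 0 → v = 0 ∨ v = fun _ => 1) :
    ¬ IsCongruentNumber (∏ i, p i) := fun h =>
  ((Wiles2000.mordellWeilRank_ne_zero_iff_isCongruentNumber
    (Nat.pos_of_ne_zero (Squarefree.ne_zero (squarefree_prod_of_injective p hp hinj)))).mpr h)
    (rank_zero_sha_two_of_oddGraph_odd p hp hinj h3 h1 hG).1

/-- **`#Sel⁽²⁾(E_n/ℚ) = 4` on Feng's family (II)** (`n = 2p₀⋯p_k`, `p₀ ≡ 5 (mod 8)`, `pᵢ ≡ 1 (mod 8)`, odd graph), unconditionally,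
uniformly in `k`. [cite: Feng1996NonCongruent, Thm. 3.1 (II) (p. 78) with Lemma 2.2 (p. 74)] [cite: SilvermanAEC2009, Thm. X.4.2] -/
theorem card_selmerGroup_two_of_oddGraph_even (hp : ∀ i, (p i).Prime) (hinj : Function.Injective p)
    (h5 : p 0 % 8 = 5) (h1 : ∀ i, i ≠ 0 → p i % 8 = 1)
    (hG : ∀ v, legendreMatrix p *ᵥ v = 0 → v = 0 ∨ v = fun _ => 1) :
    Nat.card ((congruentNumberCurve (2 * ∏ i, p i)).selmerGroup 2) = 4 :=
  card_selmerGroup_two_eq_four_of_det_even p hp (odd_of_residues p (Or.inr rfl) h5 h1) hinj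
    (det_monskyMatrixEven_eq_one_of_oddGraph p h5 h1 hG)

/-- **Rank `0` AND `Ш(E_n)[2^∞] = 0` on Feng's family (II) — UNCONDITIONAL, every `k`.** [cite: Feng1996NonCongruent, Thm. 3.1 (II) (p. 78)]
[cite: SilvermanAEC2009, Thm. X.4.2] -/
theorem rank_zero_sha_two_of_oddGraph_even (hp : ∀ i, (p i).Prime) (hinj : Function.Injective p)
    (h5 : p 0 % 8 = 5) (h1 : ∀ i, i ≠ 0 → p i % 8 = 1)
    (hG : ∀ v, legendreMatrix p *ᵥ v = 0 → v = 0 ∨ v = fun _ => 1) :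
    haveI := isElliptic_congruentNumberCurve
      (Squarefree.ne_zero (squarefree_two_mul_prod_of_injective p hp (odd_of_residues p (Or.inr rfl) h5 h1) hinj))
    (congruentNumberCurve (2 * ∏ i, p i)).mordellWeilRank = 0 ∧
      AddCommGroup.primaryComponent (congruentNumberCurve (2 * ∏ i, p i)).sha 2 = ⊥ :=
  ⟨Smith2016.mordellWeilRank_eq_zero_of_card_selmerGroup_two
      (Squarefree.ne_zero (squarefree_two_mul_prod_of_injective p hp (odd_of_residues p (Or.inr rfl) h5 h1) hinj))
      (card_selmerGroup_two_of_oddGraph_even p hp hinj h5 h1 hG),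
    Smith2016.primaryComponent_sha_two_eq_bot_of_card_selmerGroup_two
      (Squarefree.ne_zero (squarefree_two_mul_prod_of_injective p hp (odd_of_residues p (Or.inr rfl) h5 h1) hinj))
      (card_selmerGroup_two_of_oddGraph_even p hp hinj h5 h1 hG)⟩

/-- **FENG'S THEOREM 3.1 (II), unconditionally**: such `n = 2p₀⋯p_k` is NOT a congruent number. [cite: Feng1996NonCongruent, Thm. 3.1 (II) (p. 78)] -/
theorem not_isCongruentNumber_of_oddGraph_even (hp : ∀ i, (p i).Prime) (hinj : Function.Injective p)
    (h5 : p 0 % 8 = 5) (h1 : ∀ i, i ≠ 0 → p i % 8 = 1)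
    (hG : ∀ v, legendreMatrix p *ᵥ v = 0 → v = 0 ∨ v = fun _ => 1) :
    ¬ IsCongruentNumber (2 * ∏ i, p i) := fun h =>
  ((Wiles2000.mordellWeilRank_ne_zero_iff_isCongruentNumber
    (Nat.pos_of_ne_zero (Squarefree.ne_zero
      (squarefree_two_mul_prod_of_injective p hp (odd_of_residues p (Or.inr rfl) h5 h1) hinj)))).mpr h)
    (rank_zero_sha_two_of_oddGraph_even p hp hinj h5 h1 hG).1

/-- **`#Sel⁽²⁾(E_n/ℚ) = 4` on the Feng–Xiong family of Thm. 2.4** (`n = p₀⋯p_k ≡ 3 (mod 8)`, `p₀ ≡ 3 (mod 4)`, `pᵢ ≡ 1 (mod 4)`,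
`G(n)` odd in kernel form), unconditionally. [cite: Rhoades2009, Thm. 2.3 (= Feng–Xiong 2004 Thm. 2.4)] [cite: SilvermanAEC2009, Thm. X.4.2] -/
theorem card_selmerGroup_two_of_oddGraph_three_mod_four (hp : ∀ i, (p i).Prime) (hinj : Function.Injective p)
    (h3 : p 0 % 4 = 3) (h1 : ∀ i, i ≠ 0 → p i % 4 = 1) (h8 : (∏ i, p i) % 8 = 3)
    (hG : ∀ v, legendreMatrix p *ᵥ v = 0 → v = 0 ∨ v = fun _ => 1) :
    Nat.card ((congruentNumberCurve (∏ i, p i)).selmerGroup 2) = 4 := by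
  have hodd : ∀ i, Odd (p i) := by
    intro i
    rcases eq_or_ne i 0 with rfl | hi
    · exact Nat.odd_iff.mpr (by omega)
    · have := h1 i hi; exact Nat.odd_iff.mpr (by omega)
  exact card_selmerGroup_two_eq_four_of_det_odd p hp hodd hinj
    (det_monskyMatrixOdd_eq_one_of_oddGraph_three_mod_four p h3 h1 h8 hG)

/-- **Rank `0`, `Ш(E_n)[2^∞] = 0` and «not congruent» on the Feng–Xiong family of Thm. 2.4 — UNCONDITIONAL.**
[cite: Rhoades2009, Thm. 2.3 (= Feng–Xiong 2004 Thm. 2.4)] [cite: SilvermanAEC2009, Thm. X.4.2] -/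
theorem rank_zero_sha_two_of_oddGraph_three_mod_four (hp : ∀ i, (p i).Prime) (hinj : Function.Injective p)
    (h3 : p 0 % 4 = 3) (h1 : ∀ i, i ≠ 0 → p i % 4 = 1) (h8 : (∏ i, p i) % 8 = 3)
    (hG : ∀ v, legendreMatrix p *ᵥ v = 0 → v = 0 ∨ v = fun _ => 1) :
    (haveI := isElliptic_congruentNumberCurve (Squarefree.ne_zero (squarefree_prod_of_injective p hp hinj))
     (congruentNumberCurve (∏ i, p i)).mordellWeilRank = 0 ∧
      AddCommGroup.primaryComponent (congruentNumberCurve (∏ i, p i)).sha 2 = ⊥) ∧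
    ¬ IsCongruentNumber (∏ i, p i) := by
  have h4 := card_selmerGroup_two_of_oddGraph_three_mod_four p hp hinj h3 h1 h8 hG
  have hn := Squarefree.ne_zero (squarefree_prod_of_injective p hp hinj)
  have hr := Smith2016.mordellWeilRank_eq_zero_of_card_selmerGroup_two hn h4
  exact ⟨⟨hr, Smith2016.primaryComponent_sha_two_eq_bot_of_card_selmerGroup_two hn h4⟩, fun h =>
    ((Wiles2000.mordellWeilRank_ne_zero_iff_isCongruentNumber (Nat.pos_of_ne_zero hn)).mpr h) hr⟩

end Feng

/-! ## §3 Feng–Xiong Thm. 2.6 (`n = 2p₁⋯p_k`, all `pᵢ ≡ 1 (mod 4)`) -/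

section FengXiong

variable {k : ℕ} (p : Fin k → ℕ)

/-- **`#Sel⁽²⁾(E_n/ℚ) = 4` on the Feng–Xiong family of Thm. 2.6** (`n = 2p₁⋯p_k`, all `pᵢ ≡ 1 (mod 4)`, `ker(A + D₂) = 0`),
unconditionally. [cite: Rhoades2009, Thm. 2.4 (= Feng–Xiong 2004 Thm. 2.6)] [cite: SilvermanAEC2009, Thm. X.4.2] -/
theorem card_selmerGroup_two_of_oddGraph_two (hp : ∀ i, (p i).Prime) (hinj : Function.Injective p)
    (h1 : ∀ i, p i % 4 = 1) (hG' : ∀ v, (legendreMatrix p + legendreDiagonal p 2) *ᵥ v = 0 → v = 0) :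
    Nat.card ((congruentNumberCurve (2 * ∏ i, p i)).selmerGroup 2) = 4 :=
  card_selmerGroup_two_eq_four_of_det_even p hp (fun i => Nat.odd_iff.mpr (by have := h1 i; omega)) hinj
    (det_monskyMatrixEven_eq_one_of_oddGraph_two p h1 hG')

/-- **Rank `0`, `Ш(E_n)[2^∞] = 0` and «not congruent» on the Feng–Xiong family of Thm. 2.6 — UNCONDITIONAL.**
[cite: Rhoades2009, Thm. 2.4 (= Feng–Xiong 2004 Thm. 2.6)] [cite: SilvermanAEC2009, Thm. X.4.2] -/
theorem rank_zero_sha_two_of_oddGraph_two (hp : ∀ i, (p i).Prime) (hinj : Function.Injective p)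
    (h1 : ∀ i, p i % 4 = 1) (hG' : ∀ v, (legendreMatrix p + legendreDiagonal p 2) *ᵥ v = 0 → v = 0) :
    (haveI := isElliptic_congruentNumberCurve (Squarefree.ne_zero
        (squarefree_two_mul_prod_of_injective p hp (fun i => Nat.odd_iff.mpr (by have := h1 i; omega)) hinj))
     (congruentNumberCurve (2 * ∏ i, p i)).mordellWeilRank = 0 ∧
      AddCommGroup.primaryComponent (congruentNumberCurve (2 * ∏ i, p i)).sha 2 = ⊥) ∧
    ¬ IsCongruentNumber (2 * ∏ i, p i) := by
  have h4 := card_selmerGroup_two_of_oddGraph_two p hp hinj h1 hG'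
  have hn := Squarefree.ne_zero
    (squarefree_two_mul_prod_of_injective p hp (fun i => Nat.odd_iff.mpr (by have := h1 i; omega)) hinj)
  have hr := Smith2016.mordellWeilRank_eq_zero_of_card_selmerGroup_two hn h4
  exact ⟨⟨hr, Smith2016.primaryComponent_sha_two_eq_bot_of_card_selmerGroup_two hn h4⟩, fun h =>
    ((Wiles2000.mordellWeilRank_ne_zero_iff_isCongruentNumber (Nat.pos_of_ne_zero hn)).mpr h) hr⟩

end FengXiong

end CongruentNumberMonskySelmer

end Literature.NumberTheory.EllipticCurves

end
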